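import Literature.MathematicalPhysics.QuantumFieldTheory.Balaban1983to89.Node00.CarriersW
import Literature.MathematicalPhysics.QuantumFieldTheory.Balaban1983to89.B8LeafKnitZd3
import Literature.MathematicalPhysics.QuantumFieldTheory.Balaban1983to89.B8LeafModelZd3NonVacuity

/-!
# NODE 00 (YM-PLAN Track A) — STAGE 3′(X.B8) OF THE CARRIERS OF RECORD: the [Balaban1985RegularSpaces] group of `X` with its GAUGE-FIXING FAMILY PINNED to
# n05-a's full leaf carrier `B8LeafModelZd3.zdGF3` over print's admitted index («Ω_j = T_η», p. 77), its Lemma-1 carriers pinned to the non-abelian block pairs, the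
# Prop-5 ∕ Prop-6 carriers, Prop-7's axial map, the Hölder data and the constants carried as ONE explicit residual datum `ResidB8`; the pin UP-SIDE; the `b8` leaf of the
# upstream block RE-BOUND IN ITS SURVIVING FORM `B8LeafKnitRS.B8LeafRS` (`upOfRecord₅CS`); the discharge-shaped N05 sentence at the group of record BY NAME

NODE 00 CARRIER MODULE, fifth pin (seat `pub-ymgap-node00-def` g31, 2026-08-26; design `HOME/pub-ymgap-node00-def/STAGE10-CARRIERS-DESIGN-g29.md` §2 row «X.B8» +
`…-g30.md` §0; inputs = seat dag-n05-a's (KNIT-BY-NAME seat of N05) `B8LeafModelZd3` (p431428: the member `zdGF3`, Prop. 3, Thm 4), `B8LeafModelZd3Thm2` (p433715: Thm 2 on the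
`Ω₀ = ℤᵈ` sub-family), `B8LeafKnitZd3` (p434572: the discharge-shaped knit `b8LeafRS_zd3_univ`), `B8LeafKnitRS` (the re-typed leaf `B8LeafRS`, `Upstream.withB8`, OLD ⇒ NEW),
`B8LeafModelZd3Boundary` (hazard №6) and the desk notes `HOME/pub-ymgap-dag-n05-a/B8-PIN-DESIGN-g2∕g4∕g5.md`; b2b t4-dagwriter g79 (β) «no objection … the items see the re-typed
leaf only when node00-def points a Stage binding at the RS variant (their N0-6)»).  APPEND-ONLY: a NEW importing module; `CarriersW`, `Record10Carriers`, `CarriersZ ∕ Y ∕ B10`,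
`Record10`, n05-a's and the lit-balaban lineages' modules untouched and CONSUMED BY NAME.  [Balaban1985RegularSpaces] = T. Bałaban, *Spaces of regular gauge field
configurations on a lattice and gauge fixing conditions*, Commun. Math. Phys. **99** (1985) 75–102 (cell paper B8).

WHAT IS PINNED.  In `Residual₅.X P : PrintedCarriersR` the [B8] group (`I8a … I8d, d8, L8, C₂, B₁′, B₀′, B₁, B₂, c₁, inp8, B₀β, loc8, fam8, lan8, cub8, toAxial8` and the
R-extension `C140 ∕ InR ∕ proj140`) was free data at every record predicate so far (the Stage-1–3 substitutions `carriers₃` do not touch it: `CarriersFrame.carriers₁_groupB8`).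
At a [B8]-pinned parameter `θ.pinB8 lam` that group IS (`PrintedCarriersR.withB8OfRecord`): THE GAUGE-FIXING FAMILY OF RECORD `famB8OfRecord θ β len i := zdGF3 θ.𝔸 θ.L β len i.1`
over THE ADMITTED INDEX `IdxB8 θ := {i : ZdIdx θ.D θ.L ∕∕ i.Ω 0 = univ}` — all unitary `θ.𝔸`-valued configurations `U₀` on the bonds of `ℤ^{θ.D}` (coefficient algebra and gauge
group `U(θ.𝔸)` of the Stage-2 [Balaban1985Averaging] group of record, ruling Q-N00-2; `ℤᵈ`-global carriers as there), (1.33)–(1.40), (1.62), (1.66), (1.140), (1.146)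
with honest bodies through n05-a's canonical masked logarithm; `Ω₀ = ℤᵈ` because on every other member Theorem 2 and Theorem 8 are REFUTED by the Ω₀-boundary layer
(`B8LeafModelZd3Boundary.not_thm2Printed_zdGF3 ∕ not_thm8SurvivingAt_zdGF3`) while print p. 77 admits «Ω_j = T_η»; its R-extension law `proj140` PROVED (the first member
of (1.140) is (1.62) at `B = 1` on the sides touching `Ω_j`, where masked and plain logarithm agree); THE LEMMA-1 CARRIERS `blockPairNA θ.D θ.L θ.𝔸` (Lemma 1 is a kernel
theorem there, `B8Lemma1NonAbelian.lemma1Printed_blockPairNA`); `d8 := θ.D`, `L8 := θ.L`, Prop. 5's `B₀′ := inp.B₀′` (ONE constant — [4]'s).  WHAT STAYS RESIDUAL, EXPLICITLY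
(`ResidB8 θ`, quantified with the record's parameters, no law assumed): the Hölder data `β, len` (family parameters of the members); Proposition 5's carriers `lan` (the space
`R(U₀)` and the Landau-gauge equations (1.105)–(1.109) are not objects of the tree: n05-a census row p5e∕p5u, n19-b's JOIN-C); Proposition 6's cube carriers `cub`; Proposition
7's axial gauge map `toAxial` on the family of record (design point №8: `InAAx` wants `InAx` at every truncation); the inputs `B₀, B₀′` and the constants `C₂, B₁′, B₁, B₂, c₁,
B₀(β₀)` («There exist constants …», Thm 2 p. 83 — print's ∃, realised by the record's ∃ over `lam`).  NOT CARRIED (located, for a later sub-family pin if the chair words it):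
design point №7 `Lᵏη ≤ 1` and the `Λs`-truncation law №8 — t4 ∕ p3 ∕ t2 as landed do not need them.

THE `b8` LEAF IS RE-BOUND IN ITS SURVIVING FORM (node00-def's N0-6 word, this module): the bound leaf `DagBinding.B8LeafR` has `t8 := B8SectGH.Thm8PrintedAt 1`, KERNEL-REFUTED on
print's admitted flat abelian members (`B8Thm8FlatAbelianFamily.not_thm8PrintedAt`, GAPS G-B8-13; `B8LeafKnit.not_b8LeafR_of_flat_subfamily`) — a pin of honest objects under
the leaf AS TYPED would make `b8` FALSE at the record and N07 ∕ N08 ∕ N09 ∕ N12 … closable ex falso.  So the upstream block of a [B8]-pinned record is THE S-BINDING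
`upOfRecord₅CS θ P := (upOfRecord₅C θ P).withB8 (B8LeafRS … over the same bundle's [B8] group)` (n05-a's `Upstream.ofPrintedAllXPNS` pattern on top of the record's C-binding;
every other leaf untouched, `rfl`); OLD ⇒ NEW `upOfRecord₅CS_b8_of_upOfRecord₅C_b8` under the carrier law (1.36) ⊂ (1.62), which HOLDS on the family of record
(`C136_C162_famB8OfRecord`, discharge referee ref-A's condition (b)).  The record predicate with this binding and its SAME-DATUM companion in `IsRecordOfRecord₁₀CB10YZW` are
the sequel module `Node00/Record10CarriersB8`.

CONSEQUENCE, SAID (pub-ymgap R433 species): at [B8]-pinned parameters the S-binding's `b8` leaf IS `B8LeafOfRecord θ₃ lam` (`upOfRecord₅CS_pinB8_b8_iff`) — Lemma 1, Thm 2,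
Prop. 3, Thm 4 AT OBJECTS over an INHABITED index (`nonempty_idxB8`; n05-a's kernel instances modulo the five named sockets of the in-edge `b9`), Prop. 5 ∕ Prop. 6 ∕ Prop. 7 ∕
Thm 8-surviving reading residual data — so N05 is NOT bookable over this pin in ∀-form, while its discharge-shaped sentence at the group of record is `b8LeafOfRecord_of_knit`
(= `B8LeafKnitZd3.b8LeafRS_zd3_univ` BY NAME: sockets + the five residual-reading statements as hypotheses ⇒ the leaf).  THE PIN IS UP-SIDE (`datumOfRecord₅_pinB8`) and
COMMUTES with the [B10] ∕ Y ∕ Z ∕ W pins (`rfl` ×4).  KERNEL LESSON kept: no conjunction of pinned-vs-unpinned leaf `rfl`s in one declaration (heartbeats) — single-leaf `rfl`s only.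
HONEST FRAMING: definitions + kernel bookkeeping; NO estimate; nothing of [Balaban1985RegularSpaces] asserted; N05 NOT discharged; counts unmoved; one finite T⁴ programme at
fixed ε — NOT continuum ∕ ℝ⁴ ∕ infinite volume ∕ OS ∕ mass gap ∕ Clay.  No `sorry`, no `axiom`, no `opaque`, no `instance`, no `notation`. -/

noncomputable section

namespace Literature.MathematicalPhysics.QuantumFieldTheory.Balaban1983to89.Node00

open T4Continuum AveragingRT T4FiniteEpsInhabited FlowStep FlowStepRuns DagBinding T4DatumAssembly
open B8LeafKnitRS (B8LeafRS)
open B8LeafModelZd (ZdIdx)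
open B8LeafModelZd3 (zdGF3)
open B8Lemma1NonAbelian (blockPairNA)
open scoped Matrix.Norms.L2Operator

/-! ## §1. Print's admitted family index, the residual layer of the [B8] group, the group of record and what its leaf says -/

section Bundle

variable (θ : Stage3Params)

/-- **Print's admitted family index for Theorems 2 ∕ 4 ∕ 8 and Propositions 3 ∕ 7 at NODE 00's objects**: n05-a's geometric datum `ZdIdx` (spacing `η`, `k ≥ 1` levels,
the sequence `{Ω_j}`, the towers `Λ_j` and the axial-gauge bonds `𝔅`, with the box ∕ class ∕ tower ∕ partition laws) over the record's lattice dimension `θ.D` and block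
size `θ.L`, RESTRICTED to `Ω₀ = T_η` — print p. 77 «we admit … Ω_j = T_η», and the only members on which Theorem 2 ∕ Theorem 8 are not refuted by the Ω₀-boundary
layer (n05-a's `B8LeafModelZd3Boundary.not_thm2Printed_zdGF3`). [cite: Balaban1985RegularSpaces, p.77 («a sequence of domains Ω₀ ⊃ Ω₁ ⊃ … we admit Ω_j = T_η»), (1.17) p.78] -/
abbrev IdxB8 : Type := {i : ZdIdx θ.D θ.L // i.Ω 0 = Set.univ}

/-- **THE GAUGE-FIXING FAMILY OF RECORD** (Hölder exponent `β`, length function `len` of [4] (3.40)): member `i` ↦ n05-a's `zdGF3 θ.𝔸 θ.L β len i` — ALL unitary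
`θ.𝔸`-valued configurations `U₀` on the bonds of `ℤ^{θ.D}` (the coefficient algebra and gauge group `U(θ.𝔸)` of the Stage-2 [Balaban1985Averaging] group of record,
ruling Q-N00-2), (1.33)–(1.40), (1.62), (1.66), (1.140), (1.146) with honest bodies through the canonical masked logarithm.
[cite: Balaban1985RegularSpaces, (1.29) p.81, (1.33)–(1.39) p.82, (1.40) p.83, (1.62) p.87, (1.66) p.88, (1.140) p.100, (1.146) p.101] -/
def famB8OfRecord (β : ℝ) (len : B7Prop1Explicit.Site θ.D → ℝ) (i : IdxB8 θ) : B8SectGH.GFData3 :=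
  zdGF3 θ.𝔸 θ.L β len i.1

/-- **THE RESIDUAL LAYER of the [B8] group at NODE 00's objects** (data, no law): the Hölder data `β, len` (family parameters of the members), the Proposition-5
carriers (`R(U₀)` and the Landau-gauge equations — not objects of the tree today), the Proposition-6 cube carriers, Proposition 7's axial gauge map on the family of
record (design point №8 of n05-a's census), the [Balaban1985BackgroundPropagators] inputs `B₀, B₀′` and the constants `C₂, B₁′, B₁, B₂, c₁, B₀(β₀)` the leaf shares.
[cite: Balaban1985RegularSpaces, Prop. 5 p.94, Prop. 6 p.99, Prop. 7 p.100, Thm 2 p.83 («There exist constants B₁, B₂(β₀), c₁»)] -/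
structure ResidB8 where
  /-- Hölder exponent `β₀` and the length function of [4] (3.40) -/
  β : ℝ
  len : B7Prop1Explicit.Site θ.D → ℝ
  /-- Proposition 5's carriers (index and members) -/
  I8c : Type
  lan : I8c → B8.LandauData
  /-- Proposition 6's carriers (index and members) -/
  I8d : Type
  cub : I8d → B8.CubeData
  /-- Proposition 7's axial gauge map `U′ ↦ (U′U₀ in the axial gauge of 𝔅_k relative to U₀)·U₀⁻¹` on the family of record -/
  toAxial : ∀ i : IdxB8 θ, (famB8OfRecord θ β len i).Cfg → (famB8OfRecord θ β len i).Pert → (famB8OfRecord θ β len i).Pert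
  /-- [Balaban1985BackgroundPropagators] inputs `B₀, B₀′ > 0` -/
  inp : B8.B9Inputs
  /-- `C₂` (Prop. 3), `B₁′` (Thm 4), `B₁, B₂` (Thms 2 ∕ 8), `c₁`, `B₀(β₀)` -/
  (C₂ B₁' B₁ B₂ c₁ B₀β : ℝ)

variable {θ}

/-- **THE R-EXTENSION LAW `proj140` HOLDS ON THE FAMILY OF RECORD**: the first member of (1.140) («L^jη|A| < α₂ on Ω_j», read through the canonical masked logarithm)
gives the (1.62)-shape bound `C162 1 α₂` («|A| ≤ 1·α₂(L^jη)⁻¹», read through the plain logarithm) — on the sides touching `Ω_j`, `j ≤ k`, the two logarithms agree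
(`B8LeafModelZd3.mlogCfg_of_sideTouches`). [cite: Balaban1985RegularSpaces, (1.140) p.100, (1.62) p.87] -/
theorem proj140_famB8OfRecord (β : ℝ) (len : B7Prop1Explicit.Site θ.D → ℝ) (i : IdxB8 θ) (α₂ : ℝ) (U₀ : (famB8OfRecord θ β len i).Cfg)
    (U₁ : (famB8OfRecord θ β len i).Pert) (h : (famB8OfRecord θ β len i).C140 α₂ U₀ U₁) : (famB8OfRecord θ β len i).C162 1 α₂ U₀ U₁ := by
  intro j hj b hb
  obtain ⟨h₁, h₂, h₃, -, -⟩ := h j hj b.1 b.2 hb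
  have hm := B8LeafModelZd3.mlogCfg_of_sideTouches (k := i.1.k) i.1.η (Ω := i.1.Ω) U₁.2.1 hj hb
  refine ⟨?_, ?_, ?_⟩
  · rw [h₁]; exact B8Prop3GaugeFixedKLevel.cfgExp_congr_at i.1.η (by rw [hm])
  · rw [← hm]; exact h₂
  · rw [← hm, one_mul]
    have hpos : 0 < (θ.L : ℝ) ^ j * i.1.η := mul_pos (pow_pos (by exact_mod_cast lt_of_lt_of_le (by norm_num) θ.two_le_L) _) i.1.hη
    rw [← div_eq_mul_inv, le_div_iff₀ hpos, mul_comm]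
    exact h₃.le

/-- **THE [B8] GROUP OF RECORD substituted into a carrier bundle** `X`: index `IdxB8 θ`, gauge-fixing family `famB8OfRecord θ β len` (its `GFData2` part as `fam8`, its
(1.140) ∕ `R(U₀)`-membership predicates as the R-extension), Lemma-1 carriers := the non-abelian block pairs `blockPairNA θ.D θ.L θ.𝔸`, `d8 := θ.D`, `L8 := θ.L`,
Prop. 5's `B₀′ := inp.B₀′` (ONE constant, [4]'s), the other carriers and constants from the residual layer; every other group of `X` unchanged.
[cite: Balaban1985RegularSpaces, Lemma 1 p.79 – Thm 8 p.101 (the carriers of the typed statements)] -/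
def _root_.Literature.MathematicalPhysics.QuantumFieldTheory.Balaban1983to89.DagBinding.PrintedCarriersR.withB8OfRecord (X : PrintedCarriersR)
    (θ : Stage3Params) (lam : ResidB8 θ) : PrintedCarriersR :=
  { X with
    I8a := B7Prop1Explicit.Site θ.D × Fin θ.D, I8b := IdxB8 θ, I8c := lam.I8c, I8d := lam.I8d, d8 := θ.D, L8 := θ.L,
    C₂ := lam.C₂, B₁' := lam.B₁', B₀' := lam.inp.B₀', B₁ := lam.B₁, B₂ := lam.B₂, c₁ := lam.c₁, inp8 := lam.inp, B₀β := lam.B₀β,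
    loc8 := blockPairNA θ.D θ.L θ.𝔸, fam8 := fun i => (famB8OfRecord θ lam.β lam.len i).toGFData2, lan8 := lam.lan, cub8 := lam.cub,
    toAxial8 := lam.toAxial,
    C140 := fun i => (famB8OfRecord θ lam.β lam.len i).C140, InR := fun i => (famB8OfRecord θ lam.β lam.len i).InR,
    proj140 := fun i α₂ U₀ U₁ h => proj140_famB8OfRecord lam.β lam.len i α₂ U₀ U₁ h }

/-- **THE `b8` LEAF AT THE GROUP OF RECORD, IN ITS SURVIVING FORM** (`B8LeafKnitRS.B8LeafRS`: Lemma 1 p. 79, Thm 2 p. 83, Prop. 3 p. 87, Thm 4 p. 88, Prop. 5 p. 94,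
Prop. 6 p. 99, Prop. 7 p. 100 faithful, Thm 8 p. 101 SURVIVING at γ = 1) over the group of record at the residual layer `lam`.
[cite: Balaban1985RegularSpaces, Lemma 1 p.79, Thm 2 p.83, Prop. 3 p.87, Thm 4 p.88, Prop. 5 p.94, Prop. 6 p.99, Prop. 7 p.100, Thm 8 p.101 (surviving form, GAPS G-B8-13)] -/
def B8LeafOfRecord (θ : Stage3Params) (lam : ResidB8 θ) : Prop :=
  B8LeafRS θ.D (θ.L : ℝ) lam.C₂ lam.B₁' lam.inp.B₀' lam.B₁ lam.B₂ lam.c₁ lam.inp lam.B₀β (blockPairNA θ.D θ.L θ.𝔸) (famB8OfRecord θ lam.β lam.len)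
    lam.lan lam.cub lam.toAxial

/-- The surviving leaf over the SUBSTITUTED bundle's own [B8] group IS `B8LeafOfRecord θ lam` (`Iff.rfl`: the re-packaged family `fam8R` of the substituted bundle is the
family of record by structure eta). [cite: Balaban1985RegularSpaces, Lemma 1 – Thm 8 pp.79–101 (bookkeeping)] -/
theorem b8LeafRS_withB8OfRecord_iff (X : PrintedCarriersR) (θ : Stage3Params) (lam : ResidB8 θ) :
    B8LeafRS (X.withB8OfRecord θ lam).d8 (X.withB8OfRecord θ lam).L8 (X.withB8OfRecord θ lam).C₂ (X.withB8OfRecord θ lam).B₁'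
        (X.withB8OfRecord θ lam).B₀' (X.withB8OfRecord θ lam).B₁ (X.withB8OfRecord θ lam).B₂ (X.withB8OfRecord θ lam).c₁ (X.withB8OfRecord θ lam).inp8
        (X.withB8OfRecord θ lam).B₀β (X.withB8OfRecord θ lam).loc8 (X.withB8OfRecord θ lam).fam8R (X.withB8OfRecord θ lam).lan8
        (X.withB8OfRecord θ lam).cub8 (X.withB8OfRecord θ lam).toAxial8 ↔
      B8LeafOfRecord θ lam :=
  Iff.rfl

/-- The substitution does not touch the [B10] group (`rfl`) … [cite: Balaban1985UV3, (1)–(5) p.256 (bookkeeping)] -/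
theorem withB8OfRecord_runs10 (X : PrintedCarriersR) (θ : Stage3Params) (lam : ResidB8 θ) : (X.withB8OfRecord θ lam).runs10 = X.runs10 := rfl

/-- … commutes with the [B10] re-binding `withRuns10` (`rfl`) … [cite: Balaban1985UV3, (1)–(5) p.256 (bookkeeping)] -/
theorem withRuns10_withB8OfRecord (X : PrintedCarriersR) {J : Type} (r : J → B10.RunData) (θ : Stage3Params) (lam : ResidB8 θ) :
    (X.withRuns10 r).withB8OfRecord θ lam = (X.withB8OfRecord θ lam).withRuns10 r := rfl

/-- … and passes through the Stage-3 substitutions `carriers₃` (B4 ∕ B5 ∕ B6 ∕ B7 groups; `rfl`). [cite: Balaban1984PropagatorsII, pp.223–250 (bookkeeping)] -/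
theorem carriers₃_withB8OfRecord (θ₃ : Stage3Params) (X : PrintedCarriersR) (θ : Stage3Params) (lam : ResidB8 θ) :
    carriers₃ θ₃ (X.withB8OfRecord θ lam) = (carriers₃ θ₃ X).withB8OfRecord θ lam := rfl

/-- **THE CARRIER LAW (1.36) ⊂ (1.62) HOLDS ON THE FAMILY OF RECORD** (the `|A|`-member of (1.36) IS (1.62) at `B₁` — the law under which the bound leaf AS TYPED implies the
surviving one, `B8LeafKnitRS.b8LeafRS_of_b8LeafR`; discharge referee ref-A's condition (b) «EXHIBIT the law at the pin»). [cite: Balaban1985RegularSpaces, (1.36) p.82, (1.62) p.87] -/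
theorem C136_C162_famB8OfRecord (β : ℝ) (len : B7Prop1Explicit.Site θ.D → ℝ) (i : IdxB8 θ) (b b₂ s : ℝ) (U₀ : (famB8OfRecord θ β len i).Cfg)
    (U₁ : (famB8OfRecord θ β len i).Pert) (h : (famB8OfRecord θ β len i).C136 b b₂ s U₀ U₁) : (famB8OfRecord θ β len i).C162 b s U₀ U₁ :=
  h.1


/-- **N05's DISCHARGE-SHAPED SENTENCE AT THE GROUP OF RECORD — n05-a's `B8LeafKnitZd3.b8LeafRS_zd3_univ` BY NAME**: for `θ.D ≥ 2`, a residual layer whose Theorem-4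
constant is print's `B₁′ = 5dL·B₀` with `2 ≤ 5dL·B₀`, `B₀(β₀) > 0`, `C₂ ≥ 2097152(d+1)²`, the member-wise sockets of Theorem 4 (`SockHFP₀`, `SockHFP`, `SockH59`, `SockP5u`:
Proposition 5's fixed point ∕ (1.109) ∕ [4] Thm 3.3 — in-edge `b9`) and of Proposition 3 (`SockB9P3`) below their thresholds, and the five printed statements NOT YET
instantiated at objects (`p5e`, `p5u`, `p6`, `p7`, `t8` surviving) as hypotheses, THE SURVIVING LEAF HOLDS AT THE GROUP OF RECORD — `l1 t2 p3 t4` by kernel instances.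
NOT a discharge of N05. [cite: Balaban1985RegularSpaces, Lemma 1 p.79, Thm 2 p.83, Prop. 3 p.87, Thm 4 p.88 (kernel instances, n05-a); Prop. 5 p.94, Prop. 6 p.99, Prop. 7 p.100, Thm 8 p.101 (named hypotheses)] -/
theorem b8LeafOfRecord_of_knit (lam : ResidB8 θ) (hD : 2 ≤ θ.D) (hB₁' : lam.B₁' = 5 * (θ.D : ℝ) * θ.L * lam.inp.B₀)
    {cu cF₀ cF c59 cu' cB9 : ℝ} (hB : 2 ≤ 5 * (θ.D : ℝ) * θ.L * lam.inp.B₀) (hB₀β : 0 < lam.B₀β) (hC₂ : 2097152 * ((θ.D : ℝ) + 1) ^ 2 ≤ lam.C₂)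
    (hcu : 0 < cu) (hcF₀ : 0 < cF₀) (hcF : 0 < cF) (hc59 : 0 < c59) (hcu' : 0 < cu') (hcB9 : 0 < cB9)
    (SHFP₀ : ∀ i : ZdIdx θ.D θ.L, B8LeafModelZdOfHFP.SockHFP₀ (𝔸 := θ.𝔸) θ.L lam.inp.B₀ lam.inp.B₀' cF₀ i.η i.k i.Ω i.Λs)
    (SHFP : ∀ i : ZdIdx θ.D θ.L, B8LeafModelZdOfHFP.SockHFP (𝔸 := θ.𝔸) θ.L lam.inp.B₀ lam.inp.B₀' cF i.η i.k i.Ω i.Λs)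
    (SH59 : ∀ i : ZdIdx θ.D θ.L, B8LeafModelZd.SockH59 (𝔸 := θ.𝔸) θ.L lam.inp.B₀ lam.inp.B₀' c59 i.η i.k i.Ω i.Λs i.Λb)
    (SP5u : ∀ i : ZdIdx θ.D θ.L, B8LeafModelZd.SockP5u (𝔸 := θ.𝔸) θ.L cu' cu i.η i.k i.Ω i.Λs)
    (SB9 : ∀ i : ZdIdx θ.D θ.L, B8LeafModelZd3.SockB9P3 (𝔸 := θ.𝔸) θ.L lam.inp.B₀ lam.B₀β cB9 lam.β lam.len i.η i.k i.Ω i.Λs i.Λb)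
    (p5e : B8.Prop5Exists lam.inp.B₀' lam.B₁ lam.lan) (p5u : B8.Prop5Unique lam.lan) (p6 : B8.Prop6Printed θ.D (θ.L : ℝ) lam.B₁ lam.c₁ lam.cub)
    (p7 : B8SectGH.Prop7PrintedR (famB8OfRecord θ lam.β lam.len) lam.toAxial)
    (t8 : B8Thm8Surviving.Thm8SurvivingAt 1 lam.B₁ lam.B₂ (famB8OfRecord θ lam.β lam.len)) : B8LeafOfRecord θ lam := by
  rw [B8LeafOfRecord, hB₁']
  exact B8LeafKnitZd3.b8LeafRS_zd3_univ hD θ.two_le_L θ.L lam.β lam.len lam.inp hB hB₀β hC₂ hcu hcF₀ hcF hc59 hcu' hcB9 SHFP₀ SHFP SH59 SP5u SB9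
    p5e p5u p6 p7 t8

/-- **The family index of record is inhabited** — n05-a's `B8LeafModelZd3NonVacuity.exists_member_univ` BY NAME (genuine members with `Ω_j = ℤᵈ` at EVERY depth
`k ≥ 1` and spacing `η > 0`; here `k = 1`, `η = 1`): the leaf's member-wise statements `t2 t4 p3 p7 t8` are NOT vacuous at the group of record (their hypotheses are inhabited
too: `B8LeafModelZd3NonVacuity.univ_subfamily_hypotheses_inhabited`, ref-A's audit A1–A6). [cite: Balaban1985RegularSpaces, p.77 («we admit Ω_j = T_η»; bookkeeping: the admitted index is inhabited)] -/
theorem nonempty_idxB8 : Nonempty (IdxB8 θ) := by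
  obtain ⟨i, hi, -⟩ := B8LeafModelZd3NonVacuity.exists_member_univ (d := θ.D) (le_trans (by norm_num) θ.two_le_L) (le_refl 1) one_pos
  exact ⟨⟨i, hi⟩⟩

/-- The residual layer's type is inhabited (DEGENERATE inhabitant: empty Prop-5 ∕ Prop-6
families, axial map := identity, zero constants — NOT objects of record). [cite: Balaban1985RegularSpaces, Prop. 5 p.94, Prop. 6 p.99 (bookkeeping: the residual data type)] -/
theorem nonempty_residB8 : Nonempty (ResidB8 θ) :=
  ⟨{ β := 0, len := fun _ => 0, I8c := PEmpty, lan := fun i => i.elim, I8d := PEmpty, cub := fun i => i.elim, toAxial := fun _ _ U => U,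
     inp := ⟨1, 1, one_pos, one_pos⟩, C₂ := 0, B₁' := 0, B₁ := 0, B₂ := 0, c₁ := 0, B₀β := 0 }⟩

end Bundle

/-! ## §2. The pin on Stage-5 parameters (UP-SIDE) and the S-binding of the upstream block -/

section Pin

variable (F : T4Family) (N : ℕ) [NeZero N]

/-- **The [B8] pin of a Stage-5 residual**: the run-indexed carrier bundle `X P` with its [B8] group := the group of record at `(θ, lam)` (the same group at every run —
[B8]'s lattices are its own); every other field of the residual unchanged. [cite: Balaban1985RegularSpaces, Lemma 1 – Thm 8 pp.79–101 (the objects the leaf `b8` reads)] -/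
def Residual₅.pinB8 (r : Residual₅ F N) (θ : Stage3Params) (lam : ResidB8 θ) : Residual₅ F N :=
  { r with X := fun P => (r.X P).withB8OfRecord θ lam }

/-- **The [B8] pin of Stage-5 parameters** (the residual layer is typed over the parameters' OWN Stage-3 dictionary: `θ.D`, `θ.L`, `θ.𝔸`).
[cite: Balaban1985RegularSpaces, Thm 2 p.83 (objects of record, Stage 3′(X.B8))] -/
def Stage5Params.pinB8 (θ : Stage5Params F N) (lam : ResidB8 θ.toStage3Params) : Stage5Params F N :=
  { θ with res := θ.res.pinB8 F N θ.toStage3Params lam }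

/-- The pinned carrier family, unfolded (`rfl`). [cite: Balaban1985RegularSpaces, Lemma 1 – Thm 8 pp.79–101 (bookkeeping)] -/
theorem Stage5Params.pinB8_X (θ : Stage5Params F N) (lam : ResidB8 θ.toStage3Params) (P : B12.RunParams) :
    (θ.pinB8 F N lam).res.X P = (θ.res.X P).withB8OfRecord θ.toStage3Params lam := rfl

/-- The pin touches neither the Stage-3 dictionary (`rfl`) … [cite: Balaban1984PropagatorsII, pp.223–250 (bookkeeping)] -/
theorem Stage5Params.pinB8_toStage3Params (θ : Stage5Params F N) (lam : ResidB8 θ.toStage3Params) : (θ.pinB8 F N lam).toStage3Params = θ.toStage3Params := rfl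

/-- … nor admissibility (`Iff.rfl`) … [cite: Balaban1983RegularityDecay, (1.6) p.572 (hypothesis dictionary; bookkeeping)] -/
theorem Stage5Params.pinB8_admissible_iff (θ : Stage5Params F N) (lam : ResidB8 θ.toStage3Params) : (θ.pinB8 F N lam).Admissible ↔ θ.Admissible := Iff.rfl

/-- … nor the density tower (induction on `k`) … [cite: Balaban1988Convergent, (0.2) p.244 (bookkeeping)] -/
theorem densOfRecord₅_pinB8 (θ : Stage5Params F N) (lam : ResidB8 θ.toStage3Params) (p : B12.RunParams) :
    ∀ k, densOfRecord₅ F N (θ.pinB8 F N lam) p k = densOfRecord₅ F N θ p k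
  | 0 => rfl
  | k + 1 => by
    show θ.res.R p k (TrhoOfRecord F N p.K k (densOfRecord₅ F N (θ.pinB8 F N lam) p k)) =
      θ.res.R p k (TrhoOfRecord F N p.K k (densOfRecord₅ F N θ p k))
    rw [densOfRecord₅_pinB8 θ lam p k]

/-- … nor the machine … [cite: Balaban1988Convergent, (0.2) p.244 (bookkeeping)] -/
theorem machineOfRecord₅_pinB8 (θ : Stage5Params F N) (lam : ResidB8 θ.toStage3Params) : machineOfRecord₅ F N (θ.pinB8 F N lam) = machineOfRecord₅ F N θ := by
  unfold machineOfRecord₅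
  simp only [densOfRecord₅_pinB8]
  rfl

/-- … nor the assembled datum: THE PIN IS UP-SIDE. [cite: Balaban1988Convergent, (0.2) p.244 (bookkeeping)] -/
theorem datumOfRecord₅_pinB8 (θ : Stage5Params F N) (lam : ResidB8 θ.toStage3Params) : datumOfRecord₅ F N (θ.pinB8 F N lam) = datumOfRecord₅ F N θ := by
  unfold datumOfRecord₅
  rw [machineOfRecord₅_pinB8]

/-- The [B8] pin COMMUTES with the [B10] pin (`rfl`: disjoint groups of the same bundle) … [cite: Balaban1985UV3, (1)–(5) p.256; Balaban1985RegularSpaces, Thm 2 p.83 (bookkeeping)] -/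
theorem Stage5Params.pinB8_pinB10 (θ : Stage5Params F N) (lam : ResidB8 θ.toStage3Params) : (θ.pinB8 F N lam).pinB10 F N = (θ.pinB10 F N).pinB8 F N lam := rfl

/-- … with the Y pin (`rfl`) … [cite: Balaban1985BackgroundPropagators, Thm 3.1 p.397 (bookkeeping)] -/
theorem Stage5Params.pinB8_pinY (θ : Stage5Params F N) (lam : ResidB8 θ.toStage3Params) (Y₀ : PrintedCarriers9X) :
    (θ.pinB8 F N lam).pinY F N Y₀ = (θ.pinY F N Y₀).pinB8 F N lam := rfl

/-- … with the Z pin (`rfl`) … [cite: Balaban1985Variational, Thm 1 p.279 (bookkeeping)] -/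
theorem Stage5Params.pinB8_pinZ (θ : Stage5Params F N) (lam : ResidB8 θ.toStage3Params) (Z₀ : PrintedCarriers11) :
    (θ.pinB8 F N lam).pinZ F N Z₀ = (θ.pinZ F N Z₀).pinB8 F N lam := rfl

/-- … and with the W pin (`rfl`). [cite: Balaban1989LargeFieldI, (0.2) p.176 (bookkeeping)] -/
theorem Stage5Params.pinB8_pinW (θ : Stage5Params F N) (lam : ResidB8 θ.toStage3Params) (W₀ : B12.RunParams → PrintedCarriers15) :
    (θ.pinB8 F N lam).pinW F N W₀ = (θ.pinW F N W₀).pinB8 F N lam := rfl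

/-- The C-binding's `b9` leaf does not read the [B8] group (`rfl`; stated ALONE — a conjunction of such `rfl`s exhausts the default heartbeats) …
[cite: Balaban1985BackgroundPropagators, Thm 3.1 p.397 (bookkeeping)] -/
theorem upOfRecord₅C_pinB8_b9 (θ : Stage5Params F N) (lam : ResidB8 θ.toStage3Params) (P : B12.RunParams) :
    (upOfRecord₅C F N (θ.pinB8 F N lam) P).b9 = (upOfRecord₅C F N θ P).b9 := rfl

/-- … nor does `b11` (`rfl`) … [cite: Balaban1985Variational, Thm 1 p.279 (bookkeeping)] -/
theorem upOfRecord₅C_pinB8_b11 (θ : Stage5Params F N) (lam : ResidB8 θ.toStage3Params) (P : B12.RunParams) :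
    (upOfRecord₅C F N (θ.pinB8 F N lam) P).b11 = (upOfRecord₅C F N θ P).b11 := rfl

/-- … nor `rBasicStep` (`rfl`) … [cite: Balaban1989LargeFieldI, Prop. 1 p.194 (bookkeeping)] -/
theorem upOfRecord₅C_pinB8_rBasicStep (θ : Stage5Params F N) (lam : ResidB8 θ.toStage3Params) (P : B12.RunParams) :
    (upOfRecord₅C F N (θ.pinB8 F N lam) P).rBasicStep = (upOfRecord₅C F N θ P).rBasicStep := rfl

/-- … nor does `b10` (the compact [B10] node reads the run family only; through `carriers₃_withB8OfRecord`). [cite: Balaban1985UV3, Thm 1 p.257 + Thm 2 p.272 (bookkeeping)] -/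
theorem upOfRecord₅C_pinB8_b10_iff (θ : Stage5Params F N) (lam : ResidB8 θ.toStage3Params) (P : B12.RunParams) :
    (upOfRecord₅C F N (θ.pinB8 F N lam) P).b10 ↔ (upOfRecord₅C F N θ P).b10 := by
  rw [upOfRecord₅C_b10_iff, upOfRecord₅C_b10_iff, Stage5Params.pinB8_toStage3Params, Stage5Params.pinB8_X, carriers₃_withB8OfRecord]
  exact Iff.rfl

/-- **THE S-BINDING OF THE UPSTREAM BLOCK OF RECORD**: the C-binding `upOfRecord₅C θ P` (compact [B10] node, N-forms of B4 ∕ B6) with its `b8` leaf RE-BOUND to the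
SURVIVING form `B8LeafKnitRS.B8LeafRS` over the SAME bundle's [B8] group (n05-a's `Upstream.ofPrintedAllXPNS` pattern on top of the record's C-binding; every
other leaf untouched).  WHY: the bound leaf's `t8 := B8SectGH.Thm8PrintedAt 1` is kernel-refuted on print's admitted flat members (`B8Thm8FlatAbelianFamily.not_thm8PrintedAt`,
GAPS G-B8-13), so a pin of honest objects under the leaf AS TYPED would make `b8` FALSE at the record and every node downstream of it closable ex falso.
[cite: Balaban1985RegularSpaces, Lemma 1 – Thm 8 pp.79–101; Thm 8 p.101 (surviving form)] -/
def upOfRecord₅CS (θ : Stage5Params F N) (P : B12.RunParams) : Upstream :=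
  (upOfRecord₅C F N θ P).withB8
    (B8LeafRS (carriers₃ θ.toStage3Params (θ.res.X P)).d8 (carriers₃ θ.toStage3Params (θ.res.X P)).L8 (carriers₃ θ.toStage3Params (θ.res.X P)).C₂
      (carriers₃ θ.toStage3Params (θ.res.X P)).B₁' (carriers₃ θ.toStage3Params (θ.res.X P)).B₀' (carriers₃ θ.toStage3Params (θ.res.X P)).B₁
      (carriers₃ θ.toStage3Params (θ.res.X P)).B₂ (carriers₃ θ.toStage3Params (θ.res.X P)).c₁ (carriers₃ θ.toStage3Params (θ.res.X P)).inp8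
      (carriers₃ θ.toStage3Params (θ.res.X P)).B₀β (carriers₃ θ.toStage3Params (θ.res.X P)).loc8 (carriers₃ θ.toStage3Params (θ.res.X P)).fam8R
      (carriers₃ θ.toStage3Params (θ.res.X P)).lan8 (carriers₃ θ.toStage3Params (θ.res.X P)).cub8 (carriers₃ θ.toStage3Params (θ.res.X P)).toAxial8)

/-- The S-binding IS the C-binding with ONE leaf re-bound (`rfl`): every leaf other than `b8` is the C-binding's. [cite: Balaban1985RegularSpaces, Lemma 1 – Thm 8 pp.79–101 (bookkeeping)] -/
theorem upOfRecord₅CS_eq_withB8 (θ : Stage5Params F N) (P : B12.RunParams) : upOfRecord₅CS F N θ P = (upOfRecord₅C F N θ P).withB8 (upOfRecord₅CS F N θ P).b8 := rfl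

/-- OLD ⇒ NEW at the binding: the C-binding's `b8` leaf (AS TYPED) implies the S-binding's, under the carrier law (1.36) ⊂ (1.62) for the run's family.
[cite: Balaban1985RegularSpaces, Thm 8 p.101 (bookkeeping)] -/
theorem upOfRecord₅CS_b8_of_upOfRecord₅C_b8 (θ : Stage5Params F N) (P : B12.RunParams)
    (h136_162 : ∀ i b b₂ s (U₀ : ((carriers₃ θ.toStage3Params (θ.res.X P)).fam8R i).Cfg) (U₁ : ((carriers₃ θ.toStage3Params (θ.res.X P)).fam8R i).Pert),
      ((carriers₃ θ.toStage3Params (θ.res.X P)).fam8R i).C136 b b₂ s U₀ U₁ → ((carriers₃ θ.toStage3Params (θ.res.X P)).fam8R i).C162 b s U₀ U₁)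
    (h : (upOfRecord₅C F N θ P).b8) : (upOfRecord₅CS F N θ P).b8 :=
  B8LeafKnitRS.b8LeafRS_of_b8LeafR h136_162 h

/-- **THE `b8` LEAF OF THE S-BINDING AT [B8]-PINNED PARAMETERS IS THE SURVIVING LEAF AT THE GROUP OF RECORD** (`Iff.rfl` through `carriers₃_withB8OfRecord`).
[cite: Balaban1985RegularSpaces, Lemma 1 – Thm 8 pp.79–101 (the leaf at the objects of record)] -/
theorem upOfRecord₅CS_pinB8_b8_iff (θ : Stage5Params F N) (lam : ResidB8 θ.toStage3Params) (P : B12.RunParams) :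
    (upOfRecord₅CS F N (θ.pinB8 F N lam) P).b8 ↔ B8LeafOfRecord θ.toStage3Params lam :=
  Iff.rfl

/-- At [B8]-pinned parameters the carrier law (1.36) ⊂ (1.62) HOLDS (family of record), so OLD ⇒ NEW is unconditional there. [cite: Balaban1985RegularSpaces, (1.36) p.82, (1.62) p.87, Thm 8 p.101 (bookkeeping)] -/
theorem upOfRecord₅CS_pinB8_b8_of_b8 (θ : Stage5Params F N) (lam : ResidB8 θ.toStage3Params) (P : B12.RunParams)
    (h : (upOfRecord₅C F N (θ.pinB8 F N lam) P).b8) : (upOfRecord₅CS F N (θ.pinB8 F N lam) P).b8 :=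
  upOfRecord₅CS_b8_of_upOfRecord₅C_b8 F N _ P (fun i b b₂ s U₀ U₁ h' => C136_C162_famB8OfRecord lam.β lam.len i b b₂ s U₀ U₁ h') h

end Pin


/-! ## §2c (v1.1). SUB-FAMILY READINESS: the surviving leaf at the group of record passes to every sub-family of the admitted index — the form a later SUB-FAMILY pin
(located index laws №7 `Lᵏη ≤ 1`, №8 `Λs`-truncation, №11 (1.6) at every level — n05-a g5∕g6) re-keys by, without touching today's consumers -/

section SubFamily

variable {θ : Stage3Params}

/-- **THE SURVIVING LEAF PASSES TO SUB-FAMILIES** (pure logic, conjunct by conjunct: n05-a g0's `thm2Printed_precomp` ∕ `prop3Printed_precomp` ∕ `thm4Printed_precomp` ∕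
`prop7PrintedR_precomp` and `B8Thm8Surviving.thm8SurvivingAt_precomp` BY NAME; `l1`, `p5e`, `p5u`, `p6` do not read the gauge-fixing family): for every re-indexing `e : J → IdxB8 θ`
the leaf at the group of record gives the leaf over the sub-family `famB8OfRecord θ β len ∘ e` with the restricted axial map — so a successor pin on a SUB-INDEX (the located laws
№7∕№8∕№11 as a predicate on `IdxB8 θ`) is REFINED BY today's pin at the leaf, and a provider may prove the leaf on the sub-family only.
[cite: Balaban1985RegularSpaces, Lemma 1 – Thm 8 pp.79–101 (bookkeeping: restriction of the family index)] -/
theorem b8LeafOfRecord_precomp {J : Type} (e : J → IdxB8 θ) (lam : ResidB8 θ) (h : B8LeafOfRecord θ lam) :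
    B8LeafRS θ.D (θ.L : ℝ) lam.C₂ lam.B₁' lam.inp.B₀' lam.B₁ lam.B₂ lam.c₁ lam.inp lam.B₀β (blockPairNA θ.D θ.L θ.𝔸)
      (fun j => famB8OfRecord θ lam.β lam.len (e j)) lam.lan lam.cub (fun j => lam.toAxial (e j)) where
  l1 := h.l1
  t2 := B8LeafKnit.thm2Printed_precomp e (fun i => (famB8OfRecord θ lam.β lam.len i).toGFData) h.t2
  p3 := B8LeafKnit.prop3Printed_precomp e θ.D (θ.L : ℝ) lam.C₂ lam.inp lam.B₀β (fun i => (famB8OfRecord θ lam.β lam.len i).toGFData2) h.p3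
  t4 := B8LeafKnit.thm4Printed_precomp e lam.B₁' (fun i => (famB8OfRecord θ lam.β lam.len i).toGFData) h.t4
  p5e := h.p5e
  p5u := h.p5u
  p6 := h.p6
  p7 := B8LeafKnit.prop7PrintedR_precomp e (famB8OfRecord θ lam.β lam.len) lam.toAxial h.p7
  t8 := B8Thm8Surviving.thm8SurvivingAt_precomp e 1 lam.B₁ lam.B₂ (famB8OfRecord θ lam.β lam.len) h.t8

/-- In particular for a SUB-INDEX cut out by a predicate `P` on the admitted index (e.g. the located laws №7 ∧ №8 ∧ №11): the leaf at the group of record gives the leaf over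
`{i : IdxB8 θ ∕∕ P i}`. [cite: Balaban1985RegularSpaces, Lemma 1 – Thm 8 pp.79–101 (bookkeeping: restriction of the family index)] -/
theorem b8LeafOfRecord_subtype (P : IdxB8 θ → Prop) (lam : ResidB8 θ) (h : B8LeafOfRecord θ lam) :
    B8LeafRS θ.D (θ.L : ℝ) lam.C₂ lam.B₁' lam.inp.B₀' lam.B₁ lam.B₂ lam.c₁ lam.inp lam.B₀β (blockPairNA θ.D θ.L θ.𝔸)
      (fun j : {i : IdxB8 θ // P i} => famB8OfRecord θ lam.β lam.len j.1) lam.lan lam.cub (fun j => lam.toAxial j.1) :=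
  b8LeafOfRecord_precomp (fun j : {i : IdxB8 θ // P i} => j.1) lam h

end SubFamily

/-! ## §2d (v1.1). WHICH PRINTED DISPLAY THE FAMILY OF RECORD's CLOSENESS FIELD DENOTES (chair R453 (B), pub-ymgap INBOX l.11757 — wording at the pin, nothing re-typed) -/

section R453

variable {θ : Stage3Params}

/-- **R453 (B), SAID AT THE PIN.**  The family of record's closeness field `(famB8OfRecord θ β len i).avgClose α` IS n05-a's `zdGF3.avgClose` = THE BOX FORM (1.66)₁ «every
level-`j` box `⊂ Ω_j`: `‖(U′U₀)‾ʲ − Ū₀ʲ‖ ≤ α`» — STRONGER, as a hypothesis, than print's (1.35) «on Λ_j» ([Balaban1985RegularSpaces] p.82 L23 with the bond convention p.77 L13 =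
`B8Ineq132.BondTouches (Λs j)`); hence the `t2` conjunct of `B8LeafOfRecord θ lam` — `B8.Thm2Printed (famB8OfRecord θ lam.β lam.len ·)` AS TYPED — reads «THEOREM 2 WITH (1.66)₁
FOR (1.35)», a WEAKER theorem than print's Theorem 2, and the t2 ROW OF RECORD for N05 is print's Theorem 2 = this conjunct ∘ print's own (1.65) p.87 L22–38 (the `11d²` shift),
whose BRIDGE OF RECORD in the tree is `B8Ineq165AllLevels.norm_avg_sub_le_allLevels_of135` (n05-a g6, p439187) under the graded-cover law `h16` (located index law №11 «(1.6) at every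
level» — carried as an index law at a successor sub-family pin (§2c) or discharged by name for layer-indexed members).  SUPPLIER-SIDE RULE (R453 (C)): a face that FEEDS this field
from a printed (1.35)-sentence does so THROUGH that bridge with the shift displayed — never by asking its source for the box form.  This theorem is the projection `h.t2`, stated so
that the reading has a name; the pin (`famB8OfRecord`, `zdGF3.avgClose`) is untouched. [cite: Balaban1985RegularSpaces, Thm 2 p.83, (1.35) p.82, (1.65)–(1.66) pp.87–88] -/
theorem b8LeafOfRecord_t2_boxForm (lam : ResidB8 θ) (h : B8LeafOfRecord θ lam) :
    B8.Thm2Printed (fun i : IdxB8 θ => (famB8OfRecord θ lam.β lam.len i).toGFData) :=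
  h.t2

end R453

end Literature.MathematicalPhysics.QuantumFieldTheory.Balaban1983to89.Node00

end
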